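import Literature.Topology.FourManifolds.CappellShanesonClassGroupSixteen
import Literature.Topology.FourManifolds.CappellShanesonIdealCertificates
import HarnessLib

/-!
# The class group of the trace `19` field (discriminant `72329 = 151 · 479`) and Gompf's conjecture
# for the traces `19` and `-14` (Kim–Yamada 2023, Theorem B)

Serves the named fact
`Literature.Topology.FourManifolds.kimYamada2023_nonempty_diffeomorph_sphere_four_of_trace_mem_Icc`
(`CappellShaneson.lean`; M. H. Kim, S. Yamada, Kyungpook Math. J. 63 (2023) 373–411 =
arXiv:1707.03860, Cor. C), reduced in the tree to Gompf's topological leaves and Theorem B in matrix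
form (`GompfConjectureForTrace n`) for the traces not yet proved. This file PROVES Theorem B for the
trace `19` — the first trace whose class group has order `6` (at most): `C(ℤ[Θ₁₉])` is covered by the
six representatives `(1, 1, 19)`, `(8, 11, 19)`, `(5, 9, 19)`, `(4, 13, 19)`, `(2, 3, 19)`, `(3, 7, 19)`,
which move by Gompf moves to the traces `19`, `8`, `10`, `6`, `10`, `5` (Lemma 6.1 / §6.1), where
Gompf's conjecture holds — and, by Theorem A, for `-14 = 5 - 19`.

## The number theory

For a cubic number field `K` generated by a root `θ` of `f₁₉ = x³ - 19x² + 18x - 1`: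

* `Δ(f₁₉) = 72329 = 151 · 479` is squarefree, so `𝓞 K = ℤ[θ]`, `d_K = 72329`, `⌊M_K⌋ ≤ 76`;
* Dedekind–Kummer at `p ≤ 76` (Marcus, Ch. 3, Thm. 27): `2, 5, 41, 53, 67` are inert;
  `f₁₉ ≡ (x - 2)(x² + x + 2) (mod 3)`, `f₁₉ ≡ (x - 3)(x² + 5x + 5) (mod 7)`; `11` and `13` split
  (`(x - 2)(x - 8)(x - 9)`, `(x - 3)(x - 4)(x - 12)`); unique roots `8, 6, 20, 5, 19, 16, 24, 33, 9, 12,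
  13, 30` modulo `17, 19, 23, 29, 31, 37, 43, 47, 59, 61, 71, 73`;
* the group generated by the small primes has order dividing `6`: `a = [𝔭₃]`, `𝔭₃ = (3, θ - 2)`, has
  `a³ = 1` (`𝔭₃² = (9, θ - 5)`, `𝔭₃ (9, θ - 5) = (2θ - 1)`, norm `27`); `b = [𝔭₁₃']`, `𝔭₁₃' = (13, θ - 4)`,
  has `b² = 1` (`𝔭₁₃'² = (θ - 4)`, norm `169`); `g = a b = [(39, θ - 17)]` (`𝔭₃ 𝔭₁₃' = (39, θ - 17)`,
  `(39, θ - 17) 𝔭₇ = (θ - 17)`, norm `273`); every other small prime is `aⁱ bʲ` by an explicit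
  relation with certified cofactors (`𝔭₃ 𝔮₉ = (3)`, `𝔭₇ 𝔮₄₉ = (7)`, `𝔭₃ (11, θ - 2) = (θ - 2)`,
  `𝔭₇ (11, θ - 8) = (3θ - 2)`, `(11, θ - 9) 𝔭₁₃' = (4θ - 3)`, `𝔭₇ (13, θ - 3) = (θ - 3)`,
  `𝔭₃ (13, θ - 12) = (θ + 1)`, `𝔭₇ 𝔭₁₇ = (2θ + 1)`, `𝔭₁₃' 𝔭₁₉ = (3θ + 1)`, `(11, θ - 8) 𝔭₂₃ = (θ + 3)`,
  `(9, θ - 5) 𝔭₂₉ = (θ - 5)`, `(11, θ - 8) 𝔭₃₁ = (θ² - θ - 1)`, `(13, θ - 3) 𝔭₃₇ = (θ - 16)`,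
  `(11, θ - 8) 𝔭₄₃ = (2θ - 5)`, `(11, θ - 9) 𝔭₄₇ = (3θ - 5)`, `(11, θ - 9) 𝔭₅₉ = (θ - 9)`,
  `(11, θ - 2) 𝔭₆₁ = (5θ + 1)`, `(11, θ - 2) 𝔭₇₁ = (θ - 13)`, `𝔭₃ 𝔭₇₃ = (5θ - 4)`);
* hence every ideal class is one of `g⁰, …, g⁵` (`classGroup_mem_six_nineteen`).

Transport to `ℤ[X]/(f₁₉)` and Prop. 2.14 (`exists_isConj_standardCSMatrix_of_cover`):
`isConj_standardCSMatrix_of_trace_eq_nineteen`, `gompfConjectureForTrace_nineteen`,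
`gompfConjectureForTrace_neg_fourteen`. No named fact is introduced (D-0026).

## References

* [KimYamada2023] M. H. Kim, S. Yamada, Kyungpook Math. J. 63 (2023) 373–411 (arXiv:1707.03860):
  §2.3 (Prop. 2.14), §5 (Table 2), §6.1 (Lemma 6.1 and the proof of Thm. B), Thm. A.
* [Marcus2018] D. A. Marcus, *Number Fields*, 2nd ed., Ch. 3, Thm. 27 (Dedekind–Kummer); Ch. 5,
  Cor. 2 of Thm. 37 (Minkowski bound).
-/

noncomputable section

open Set Polynomial Module NumberField Ideal
open scoped NumberField MatrixGroups nonZeroDivisors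
open Literature.LinearAlgebra.Matrix

namespace Literature.Topology.FourManifolds


section Field

variable {K : Type*} [Field K] [NumberField K] {θ : K}

/-! ### Discriminant `72329` and `𝓞 K = ℤ[θ]` -/

/-- `Δ(f₁₉) = 19·17·16·14 - 23 = 72329`. [cite: KimYamada2023, §3 (Δ(fₙ) = n(n-2)(n-3)(n-5) - 23)] -/
theorem csDisc_nineteen : csDisc 19 = 72329 := by
  decide

set_option maxRecDepth 8192 in
/-- `72329 = 151 · 479` is squarefree, so `Δ(f₁₉)` has no factorisation `r² e` with `|e| > 2`,
`r ≠ ±1`, and `𝓞 K = ℤ[θ]`. [folklore] -/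
theorem csDisc_nineteen_sq : ∀ r e : ℤ, csDisc 19 = r ^ 2 * e → 2 < |e| → IsUnit r :=
  isUnit_of_eq_sq_mul (B := 268) (by decide) (by decide) (by decide)

/-- `d_K = 72329` for the trace `19` field. [folklore] -/
theorem discr_eq_nineteen (hθ : aeval θ (csPoly 19) = 0) (h3 : finrank ℚ K = 3) :
    NumberField.discr K = 72329 := by
  rw [discr_eq_csDisc_of_sq hθ h3 csDisc_nineteen_sq, csDisc_nineteen]

/-- The cubic relation `θ³ - 19θ² + 18θ - 1 = 0` in `𝓞 K`. [folklore] -/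
theorem thetaInt_rel_nineteen (hθ : aeval θ (csPoly 19) = 0) :
    (thetaInt hθ) ^ 3 - 19 * (thetaInt hθ) ^ 2 + 18 * thetaInt hθ - 1 = 0 := by
  have rel := thetaInt_rel hθ
  push_cast at rel
  linear_combination rel

/-! ### The primes of norm at most `76` (Dedekind–Kummer) -/

set_option maxRecDepth 16384 in
/-- The inert primes `2, 5, 41, 53, 67` (no root of `f₁₉`): every prime above them is `(p)`. [folklore] -/
theorem eq_span_of_inert_nineteen (hθ : aeval θ (csPoly 19) = 0) (h3 : finrank ℚ K = 3) {p : ℕ}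
    (hp : p = 2 ∨ p = 5 ∨ p = 41 ∨ p = 53 ∨ p = 67)
    {P : Ideal (𝓞 K)} (hP : P ∈ primesOver (span {(p : ℤ)}) (𝓞 K)) : P = span {(p : 𝓞 K)} := by
  rcases hp with rfl | rfl | rfl | rfl | rfl
  · exact eq_span_of_no_root_of_sq hθ h3 csDisc_nineteen_sq (by norm_num) hP (by decide)
  · exact eq_span_of_no_root_of_sq hθ h3 csDisc_nineteen_sq (by norm_num) hP (by decide)
  · exact eq_span_of_no_root_of_sq hθ h3 csDisc_nineteen_sq (by norm_num) hP (by decide)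
  · exact eq_span_of_no_root_of_sq hθ h3 csDisc_nineteen_sq (by norm_num) hP (by decide)
  · exact eq_span_of_no_root_of_sq hθ h3 csDisc_nineteen_sq (by norm_num) hP (by decide)

set_option maxRecDepth 16384 in
/-- The degree-one primes at primes with a unique root of `f₁₉`: `(17, θ - 8)`, `(19, θ - 6)`, `(23, θ - 20)`, `(29, θ - 5)`, `(31, θ - 19)`, `(37, θ - 16)`, `(43, θ - 24)`, `(47, θ - 33)`, `(59, θ - 9)`, `(61, θ - 12)`, `(71, θ - 13)`, `(73, θ - 30)` are the only
primes `P` above them with `p ^ {f_P} ≤ 76`. [folklore] -/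
theorem eq_span_pair_of_unique_root_nineteen (hθ : aeval θ (csPoly 19) = 0) (h3 : finrank ℚ K = 3)
    {p : ℕ} {c₀ : ℤ}
    (hp : (p = 17 ∧ c₀ = 8) ∨ (p = 19 ∧ c₀ = 6) ∨ (p = 23 ∧ c₀ = 20) ∨ (p = 29 ∧ c₀ = 5) ∨ (p = 31 ∧ c₀ = 19) ∨ (p = 37 ∧ c₀ = 16) ∨ (p = 43 ∧ c₀ = 24) ∨ (p = 47 ∧ c₀ = 33) ∨ (p = 59 ∧ c₀ = 9) ∨ (p = 61 ∧ c₀ = 12) ∨ (p = 71 ∧ c₀ = 13) ∨ (p = 73 ∧ c₀ = 30))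
    {P : Ideal (𝓞 K)} (hP : P ∈ primesOver (span {(p : ℤ)}) (𝓞 K)) (hle : p ^ P.inertiaDeg ℤ ≤ 76) :
    P = span {(p : 𝓞 K), thetaInt hθ - (c₀ : 𝓞 K)} := by
  rcases hp with ⟨rfl, rfl⟩ | ⟨rfl, rfl⟩ | ⟨rfl, rfl⟩ | ⟨rfl, rfl⟩ | ⟨rfl, rfl⟩ | ⟨rfl, rfl⟩ | ⟨rfl, rfl⟩ | ⟨rfl, rfl⟩ | ⟨rfl, rfl⟩ | ⟨rfl, rfl⟩ | ⟨rfl, rfl⟩ | ⟨rfl, rfl⟩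
  · exact eq_span_pair_of_unique_root_of_sq hθ h3 csDisc_nineteen_sq (by norm_num) hP hle
      (by decide) (by norm_num)
  · exact eq_span_pair_of_unique_root_of_sq hθ h3 csDisc_nineteen_sq (by norm_num) hP hle
      (by decide) (by norm_num)
  · exact eq_span_pair_of_unique_root_of_sq hθ h3 csDisc_nineteen_sq (by norm_num) hP hle
      (by decide) (by norm_num)
  · exact eq_span_pair_of_unique_root_of_sq hθ h3 csDisc_nineteen_sq (by norm_num) hP hle
      (by decide) (by norm_num)
  · exact eq_span_pair_of_unique_root_of_sq hθ h3 csDisc_nineteen_sq (by norm_num) hP hle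
      (by decide) (by norm_num)
  · exact eq_span_pair_of_unique_root_of_sq hθ h3 csDisc_nineteen_sq (by norm_num) hP hle
      (by decide) (by norm_num)
  · exact eq_span_pair_of_unique_root_of_sq hθ h3 csDisc_nineteen_sq (by norm_num) hP hle
      (by decide) (by norm_num)
  · exact eq_span_pair_of_unique_root_of_sq hθ h3 csDisc_nineteen_sq (by norm_num) hP hle
      (by decide) (by norm_num)
  · exact eq_span_pair_of_unique_root_of_sq hθ h3 csDisc_nineteen_sq (by norm_num) hP hle
      (by decide) (by norm_num)
  · exact eq_span_pair_of_unique_root_of_sq hθ h3 csDisc_nineteen_sq (by norm_num) hP hle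
      (by decide) (by norm_num)
  · exact eq_span_pair_of_unique_root_of_sq hθ h3 csDisc_nineteen_sq (by norm_num) hP hle
      (by decide) (by norm_num)
  · exact eq_span_pair_of_unique_root_of_sq hθ h3 csDisc_nineteen_sq (by norm_num) hP hle
      (by decide) (by norm_num)

/-- `f₁₉ = (x - 2)(x^2 + x + 2) + 3(-6 * x^2 + 6 * x + 1)`: the factorisation modulo `3`. [folklore] -/
theorem csPoly_nineteen_eq_three :
    csPoly 19 = (X - 2) * (X ^ 2 + X + 2) + 3 * (-6 * X ^ 2 + 6 * X + 1) := by
  simp only [csPoly, map_sub, map_one, map_ofNat]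
  ring

/-- `f₁₉ mod 3 = (x - 2)·(X ^ 2 + X + 2)`. [folklore] -/
theorem csPolyMod_nineteen_three :
    csPolyMod 19 3 = (X - C ((2 : ℤ) : ZMod 3)) *
      (X ^ 2 + X + 2 : ℤ[X]).map (Int.castRingHom (ZMod 3)) := by
  rw [csPolyMod, csPoly_nineteen_eq_three, Polynomial.map_add]
  have hp : Polynomial.map (Int.castRingHom (ZMod 3)) (3 * (-6 * X ^ 2 + 6 * X + 1) : ℤ[X]) = 0 := by
    rw [Polynomial.map_mul, show (3 : ℤ[X]) = C 3 from rfl, Polynomial.map_C]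
    have : (Int.castRingHom (ZMod 3)) 3 = 0 := by decide
    rw [this, C_0, zero_mul]
  rw [hp, add_zero, map_quad_sixteen_three]
  simp only [Polynomial.map_mul, Polynomial.map_sub, Polynomial.map_add, Polynomial.map_pow, map_X,
    Polynomial.map_ofNat, Int.cast_ofNat, map_ofNat]

/-- **The primes above `3`**: `(3, θ - 2)` (degree one) and `(3, θ ^ 2 + θ + 2)` (degree two). [folklore] -/
theorem eq_P3_or_eq_Q3_nineteen (hθ : aeval θ (csPoly 19) = 0) (h3 : finrank ℚ K = 3)
    {P : Ideal (𝓞 K)} (hP : P ∈ primesOver (span {((3 : ℕ) : ℤ)}) (𝓞 K)) :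
    P = span {(3 : 𝓞 K), thetaInt hθ - 2} ∨
      P = span {(3 : 𝓞 K), thetaInt hθ ^ 2 + thetaInt hθ + 2} := by
  rcases eq_span_pair_of_linear_mul_quadratic_of_sq hθ h3 csDisc_nineteen_sq (by norm_num)
    monic_quad_sixteen_three irreducible_quad_sixteen_three csPolyMod_nineteen_three hP with h | h
  · left; simpa using h
  · right
    simp only [map_add, map_pow, aeval_X, map_ofNat] at h
    simpa using h

/-- `f₁₉ = (x - 3)(x^2 + 5 * x + 5) + 7(-3 * x^2 + 4 * x + 2)`: the factorisation modulo `7`. [folklore] -/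
theorem csPoly_nineteen_eq_seven :
    csPoly 19 = (X - 3) * (X ^ 2 + 5 * X + 5) + 7 * (-3 * X ^ 2 + 4 * X + 2) := by
  simp only [csPoly, map_sub, map_one, map_ofNat]
  ring

/-- The lift `X ^ 2 + 5 * X + 5` reduces modulo `7` to the same expression in `𝔽₇[x]`. [folklore] -/
theorem map_quad_nineteen_seven :
    (X ^ 2 + 5 * X + 5 : ℤ[X]).map (Int.castRingHom (ZMod 7)) = X ^ 2 + 5 * X + 5 := by
  simp only [Polynomial.map_add, Polynomial.map_mul, Polynomial.map_pow, map_X, Polynomial.map_ofNat]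

/-- `f₁₉ mod 7 = (x - 3)·(X ^ 2 + 5 * X + 5)`. [folklore] -/
theorem csPolyMod_nineteen_seven :
    csPolyMod 19 7 = (X - C ((3 : ℤ) : ZMod 7)) *
      (X ^ 2 + 5 * X + 5 : ℤ[X]).map (Int.castRingHom (ZMod 7)) := by
  rw [csPolyMod, csPoly_nineteen_eq_seven, Polynomial.map_add]
  have hp : Polynomial.map (Int.castRingHom (ZMod 7)) (7 * (-3 * X ^ 2 + 4 * X + 2) : ℤ[X]) = 0 := by
    rw [Polynomial.map_mul, show (7 : ℤ[X]) = C 7 from rfl, Polynomial.map_C]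
    have : (Int.castRingHom (ZMod 7)) 7 = 0 := by decide
    rw [this, C_0, zero_mul]
  rw [hp, add_zero, map_quad_nineteen_seven]
  simp only [Polynomial.map_mul, Polynomial.map_sub, Polynomial.map_add, Polynomial.map_pow, map_X,
    Polynomial.map_ofNat, Int.cast_ofNat, map_ofNat]

/-- `X ^ 2 + 5 * X + 5` is monic over `𝔽₇`. [folklore] -/
theorem monic_quad_nineteen_seven :
    ((X ^ 2 + 5 * X + 5 : ℤ[X]).map (Int.castRingHom (ZMod 7))).Monic := by
  rw [map_quad_nineteen_seven]
  monicity!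

/-- `X ^ 2 + 5 * X + 5` has no root modulo `7`. [folklore] -/
theorem quad_nineteen_seven_ne_zero : ∀ c : ZMod 7, c ^ 2 + 5 * c + 5 ≠ 0 := by
  decide

/-- `X ^ 2 + 5 * X + 5` is irreducible over `𝔽₇`. [folklore] -/
theorem irreducible_quad_nineteen_seven :
    Irreducible ((X ^ 2 + 5 * X + 5 : ℤ[X]).map (Int.castRingHom (ZMod 7))) := by
  haveI := Fact.mk (show Nat.Prime 7 by norm_num)
  rw [map_quad_nineteen_seven]
  have hdeg : (X ^ 2 + 5 * X + 5 : (ZMod 7)[X]).natDegree = 2 := by compute_degree!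
  refine irreducible_of_degree_le_three_of_not_isRoot (by rw [hdeg]; decide) fun c hc =>
    quad_nineteen_seven_ne_zero c ?_
  have h := hc
  rw [IsRoot.def] at h
  simpa using h

/-- **The primes above `7`**: `(7, θ - 3)` (degree one) and `(7, θ ^ 2 + 5 * θ + 5)` (degree two). [folklore] -/
theorem eq_P7_or_eq_Q7_nineteen (hθ : aeval θ (csPoly 19) = 0) (h3 : finrank ℚ K = 3)
    {P : Ideal (𝓞 K)} (hP : P ∈ primesOver (span {((7 : ℕ) : ℤ)}) (𝓞 K)) :
    P = span {(7 : 𝓞 K), thetaInt hθ - 3} ∨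
      P = span {(7 : 𝓞 K), thetaInt hθ ^ 2 + 5 * thetaInt hθ + 5} := by
  rcases eq_span_pair_of_linear_mul_quadratic_of_sq hθ h3 csDisc_nineteen_sq (by norm_num)
    monic_quad_nineteen_seven irreducible_quad_nineteen_seven csPolyMod_nineteen_seven hP with h | h
  · left; simpa using h
  · right
    simp only [map_add, map_mul, map_pow, aeval_X, map_ofNat] at h
    simpa using h

/-- `f₁₉ = (x - 2)(x - 8)(x - 9) + 11(-8 * x + 13)`: `f₁₉ ≡ (x - 2)(x - 8)(x - 9) (mod 11)`. [folklore] -/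
theorem csPoly_nineteen_eq_eleven :
    csPoly 19 = (X - 2) * (X - 8) * (X - 9) + 11 * (-8 * X + 13) := by
  simp only [csPoly, map_sub, map_one, map_ofNat]
  ring

/-- `f₁₉ mod 11 = (x - 2)(x - 8)(x - 9)`. [folklore] -/
theorem csPolyMod_nineteen_eleven :
    csPolyMod 19 11 = (X - C ((2 : ℤ) : ZMod 11)) * (X - C ((8 : ℤ) : ZMod 11)) *
      (X - C ((9 : ℤ) : ZMod 11)) := by
  rw [csPolyMod, csPoly_nineteen_eq_eleven, Polynomial.map_add]
  have hp : Polynomial.map (Int.castRingHom (ZMod 11)) (11 * (-8 * X + 13) : ℤ[X]) = 0 := by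
    rw [Polynomial.map_mul, show (11 : ℤ[X]) = C 11 from rfl, Polynomial.map_C]
    have : (Int.castRingHom (ZMod 11)) 11 = 0 := by decide
    rw [this, C_0, zero_mul]
  rw [hp, add_zero]
  simp only [Polynomial.map_mul, Polynomial.map_sub, map_X, Polynomial.map_ofNat, Int.cast_ofNat,
    map_ofNat]

/-- **The primes above `11`**: `(11, θ - 2)`, `(11, θ - 8)`, `(11, θ - 9)`. [folklore] -/
theorem eq_P11_nineteen (hθ : aeval θ (csPoly 19) = 0) (h3 : finrank ℚ K = 3)
    {P : Ideal (𝓞 K)} (hP : P ∈ primesOver (span {((11 : ℕ) : ℤ)}) (𝓞 K)) :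
    P = span {(11 : 𝓞 K), thetaInt hθ - 2} ∨ P = span {(11 : 𝓞 K), thetaInt hθ - 8} ∨
      P = span {(11 : 𝓞 K), thetaInt hθ - 9} := by
  rcases eq_span_pair_of_split_of_sq hθ h3 csDisc_nineteen_sq (by norm_num)
    csPolyMod_nineteen_eleven hP with h | h | h
  · left; simpa using h
  · right; left; simpa using h
  · right; right; simpa using h

/-- `f₁₉ = (x - 3)(x - 4)(x - 12) + 13(-6 * x + 11)`: `f₁₉ ≡ (x - 3)(x - 4)(x - 12) (mod 13)`. [folklore] -/
theorem csPoly_nineteen_eq_thirteen :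
    csPoly 19 = (X - 3) * (X - 4) * (X - 12) + 13 * (-6 * X + 11) := by
  simp only [csPoly, map_sub, map_one, map_ofNat]
  ring

/-- `f₁₉ mod 13 = (x - 3)(x - 4)(x - 12)`. [folklore] -/
theorem csPolyMod_nineteen_thirteen :
    csPolyMod 19 13 = (X - C ((3 : ℤ) : ZMod 13)) * (X - C ((4 : ℤ) : ZMod 13)) *
      (X - C ((12 : ℤ) : ZMod 13)) := by
  rw [csPolyMod, csPoly_nineteen_eq_thirteen, Polynomial.map_add]
  have hp : Polynomial.map (Int.castRingHom (ZMod 13)) (13 * (-6 * X + 11) : ℤ[X]) = 0 := by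
    rw [Polynomial.map_mul, show (13 : ℤ[X]) = C 13 from rfl, Polynomial.map_C]
    have : (Int.castRingHom (ZMod 13)) 13 = 0 := by decide
    rw [this, C_0, zero_mul]
  rw [hp, add_zero]
  simp only [Polynomial.map_mul, Polynomial.map_sub, map_X, Polynomial.map_ofNat, Int.cast_ofNat,
    map_ofNat]

/-- **The primes above `13`**: `(13, θ - 3)`, `(13, θ - 4)`, `(13, θ - 12)`. [folklore] -/
theorem eq_P13_nineteen (hθ : aeval θ (csPoly 19) = 0) (h3 : finrank ℚ K = 3)
    {P : Ideal (𝓞 K)} (hP : P ∈ primesOver (span {((13 : ℕ) : ℤ)}) (𝓞 K)) :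
    P = span {(13 : 𝓞 K), thetaInt hθ - 3} ∨ P = span {(13 : 𝓞 K), thetaInt hθ - 4} ∨
      P = span {(13 : 𝓞 K), thetaInt hθ - 12} := by
  rcases eq_span_pair_of_split_of_sq hθ h3 csDisc_nineteen_sq (by norm_num)
    csPolyMod_nineteen_thirteen hP with h | h | h
  · left; simpa using h
  · right; left; simpa using h
  · right; right; simpa using h

/-! ### Relations among the small primes: explicit generators -/

/-- **`𝔭₃² = (9, θ - 5)`** (`5 ≡ 2 (mod 3)` is the root of `f₁₉` modulo `9`). [folklore] -/
theorem P3_mul_P3_nineteen (hθ : aeval θ (csPoly 19) = 0) :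
    span {(3 : 𝓞 K), thetaInt hθ - 2} * span {(3 : 𝓞 K), thetaInt hθ - 2} =
      span {(9 : 𝓞 K), thetaInt hθ - 5} := by
  have rel := thetaInt_rel_nineteen hθ
  set t := thetaInt hθ with ht
  exact span_pair_mul_span_pair_eq_span_pair
    (α₁ := 1) (β₁ := 0)
    (α₂ := 1) (β₂ := 3)
    (α₃ := 1) (β₃ := 3)
    (α₄ := -399 * t ^ 2) (β₄ := 344 * t ^ 2 - 1224 * t + 68)
    (u₁ := 1) (u₂ := 0) (u₃ := 0) (u₄ := 0)
    (v₁ := 131 * t ^ 2) (v₂ := 690 * t) (v₃ := 0) (v₄ := -69 * t ^ 2 + 1030 * t)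
    (by ring) (by ring) (by ring) (by linear_combination (-344 : 𝓞 K) * rel)
    (by ring) (by linear_combination (69 * t + 5) * rel)

/-- **`𝔭₃ (9, θ - 5) = (2θ - 1)`** (`N(2θ - 1) = -27`): with `𝔭₃² = (9, θ - 5)`, `[𝔭₃]³ = 1`. [folklore] -/
theorem P3_mul_P9_nineteen (hθ : aeval θ (csPoly 19) = 0) :
    span {(3 : 𝓞 K), thetaInt hθ - 2} * span {(9 : 𝓞 K), thetaInt hθ - 5} =
      span {2 * thetaInt hθ - 1} := by
  have rel := thetaInt_rel_nineteen hθ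
  set t := thetaInt hθ with ht
  exact span_pair_mul_span_pair_eq_span_singleton
    (δ₁ := -4 * t ^ 2 + 74 * t - 35) (δ₂ := 2 * t ^ 2 - 37 * t + 19)
    (δ₃ := 2 * t ^ 2 - 37 * t + 22) (δ₄ := -t ^ 2 + 19 * t - 12)
    (u₁ := 12 * t ^ 2) (u₂ := 48 * t) (u₃ := 0) (u₄ := -6 * t ^ 2 + 71 * t)
    (by linear_combination (8 : 𝓞 K) * rel) (by linear_combination (-4 : 𝓞 K) * rel)
    (by linear_combination (-4 : 𝓞 K) * rel) (by linear_combination (2 : 𝓞 K) * rel)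
    (by linear_combination (6 * t + 1) * rel)

/-- **`(13, θ - 4)² = (θ - 4)`** (`N(θ - 4) = 169`): the class of `𝔭₁₃' = (13, θ - 4)` has order `≤ 2`. [folklore] -/
theorem P13b_mul_P13b_nineteen (hθ : aeval θ (csPoly 19) = 0) :
    span {(13 : 𝓞 K), thetaInt hθ - 4} * span {(13 : 𝓞 K), thetaInt hθ - 4} =
      span {thetaInt hθ - 4} := by
  have rel := thetaInt_rel_nineteen hθ
  set t := thetaInt hθ with ht
  exact span_pair_mul_span_pair_eq_span_singleton
    (δ₁ := t ^ 2 - 15 * t - 42) (δ₂ := 13)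
    (δ₃ := 13) (δ₄ := t - 4)
    (u₁ := 51 * t ^ 2 - 7 * t) (u₂ := 0) (u₃ := 0) (u₄ := -788 * t + 49)
    (by linear_combination (-1 : 𝓞 K) * rel) (by ring)
    (by ring) (by ring)
    (by linear_combination (788 : 𝓞 K) * rel)

/-- **`𝔭₃ 𝔭₁₃' = (39, θ - 17)`** (`17 ≡ 2 (mod 3)`, `17 ≡ 4 (mod 13)`). [folklore] -/
theorem P3_mul_P13b_nineteen (hθ : aeval θ (csPoly 19) = 0) :
    span {(3 : 𝓞 K), thetaInt hθ - 2} * span {(13 : 𝓞 K), thetaInt hθ - 4} =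
      span {(39 : 𝓞 K), thetaInt hθ - 17} := by
  have rel := thetaInt_rel_nineteen hθ
  set t := thetaInt hθ with ht
  exact span_pair_mul_span_pair_eq_span_pair
    (α₁ := 1) (β₁ := 0)
    (α₂ := 1) (β₂ := 3)
    (α₃ := 5) (β₃ := 13)
    (α₄ := -57 * t ^ 2) (β₄ := 2354 * t ^ 2 - 2484 * t + 138)
    (u₁ := 1) (u₂ := 0) (u₃ := 0) (u₄ := 0)
    (v₁ := -1) (v₂ := -4) (v₃ := 1) (v₄ := 0)
    (by ring) (by ring) (by ring) (by linear_combination (-2354 : 𝓞 K) * rel)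
    (by ring) (by ring)

/-- **`(39, θ - 17) 𝔭₇ = (θ - 17)`** (`N(θ - 17) = 273 = 3·7·13`): `[𝔭₇] = ([𝔭₃][𝔭₁₃'])⁻¹`. [folklore] -/
theorem P39_mul_P7_nineteen (hθ : aeval θ (csPoly 19) = 0) :
    span {(39 : 𝓞 K), thetaInt hθ - 17} * span {(7 : 𝓞 K), thetaInt hθ - 3} =
      span {thetaInt hθ - 17} := by
  have rel := thetaInt_rel_nineteen hθ
  set t := thetaInt hθ with ht
  exact span_pair_mul_span_pair_eq_span_singleton
    (δ₁ := t ^ 2 - 2 * t - 16) (δ₂ := 2 * t ^ 2 - 4 * t + 7)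
    (δ₃ := 7) (δ₄ := t - 3)
    (u₁ := -4) (u₂ := 2) (u₃ := -11) (u₄ := 0)
    (by linear_combination (-1 : 𝓞 K) * rel) (by linear_combination (-2 : 𝓞 K) * rel)
    (by ring) (by ring)
    (by ring)

/-- **`𝔭₃ 𝔮₉ = (3)`**, `𝔮₉ = (3, θ² + θ + 2)` (`f₁₉ ≡ (x - 2)(x² + x + 2) (mod 3)`). [folklore] -/
theorem P3_mul_Q3_nineteen (hθ : aeval θ (csPoly 19) = 0) :
    span {(3 : 𝓞 K), thetaInt hθ - 2} * span {(3 : 𝓞 K), thetaInt hθ ^ 2 + thetaInt hθ + 2} =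
      span {3} := by
  have rel := thetaInt_rel_nineteen hθ
  set t := thetaInt hθ with ht
  exact span_pair_mul_span_pair_eq_span_singleton
    (δ₁ := 3) (δ₂ := t ^ 2 + t + 2)
    (δ₃ := t - 2) (δ₄ := 6 * t ^ 2 - 6 * t - 1)
    (u₁ := -12) (u₂ := 6) (u₃ := -12) (u₄ := -1)
    (by ring) (by ring)
    (by ring) (by linear_combination (1 : 𝓞 K) * rel)
    (by linear_combination (1 : 𝓞 K) * rel)

/-- **`𝔭₇ 𝔮₄₉ = (7)`**, `𝔮₄₉ = (7, θ² + 5θ + 5)` (`f₁₉ ≡ (x - 3)(x² + 5x + 5) (mod 7)`). [folklore] -/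
theorem P7_mul_Q7_nineteen (hθ : aeval θ (csPoly 19) = 0) :
    span {(7 : 𝓞 K), thetaInt hθ - 3} * span {(7 : 𝓞 K), thetaInt hθ ^ 2 + 5 * thetaInt hθ + 5} =
      span {7} := by
  have rel := thetaInt_rel_nineteen hθ
  set t := thetaInt hθ with ht
  exact span_pair_mul_span_pair_eq_span_singleton
    (δ₁ := 7) (δ₂ := t ^ 2 + 5 * t + 5)
    (δ₃ := t - 3) (δ₄ := 3 * t ^ 2 - 4 * t - 2)
    (u₁ := -21) (u₂ := 6) (u₃ := -38) (u₄ := -2)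
    (by ring) (by ring)
    (by ring) (by linear_combination (1 : 𝓞 K) * rel)
    (by linear_combination (2 : 𝓞 K) * rel)

/-- **`𝔭₃ (11, θ - 2) = (θ - 2)`** (`N = 33`). [folklore] -/
theorem P3_mul_P11a_nineteen (hθ : aeval θ (csPoly 19) = 0) :
    span {(3 : 𝓞 K), thetaInt hθ - 2} * span {(11 : 𝓞 K), thetaInt hθ - 2} =
      span {thetaInt hθ - 2} := by
  have rel := thetaInt_rel_nineteen hθ
  set t := thetaInt hθ with ht
  exact span_pair_mul_span_pair_eq_span_singleton
    (δ₁ := t ^ 2 - 17 * t - 16) (δ₂ := 3)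
    (δ₃ := 11) (δ₄ := t - 2)
    (u₁ := 0) (u₂ := 4) (u₃ := -1) (u₄ := 0)
    (by linear_combination (-1 : 𝓞 K) * rel) (by ring)
    (by ring) (by ring)
    (by ring)

/-- **`𝔭₇ (11, θ - 8) = (3θ - 2)`** (`N = -77`). [folklore] -/
theorem P7_mul_P11b_nineteen (hθ : aeval θ (csPoly 19) = 0) :
    span {(7 : 𝓞 K), thetaInt hθ - 3} * span {(11 : 𝓞 K), thetaInt hθ - 8} =
      span {3 * thetaInt hθ - 2} := by
  have rel := thetaInt_rel_nineteen hθ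
  set t := thetaInt hθ with ht
  exact span_pair_mul_span_pair_eq_span_singleton
    (δ₁ := -9 * t ^ 2 + 165 * t - 52) (δ₂ := 6 * t ^ 2 - 110 * t + 37)
    (δ₃ := 3 * t ^ 2 - 55 * t + 21) (δ₄ := -2 * t ^ 2 + 37 * t - 15)
    (u₁ := 1) (u₂ := 2) (u₃ := -1) (u₄ := 0)
    (by linear_combination (27 : 𝓞 K) * rel) (by linear_combination (-18 : 𝓞 K) * rel)
    (by linear_combination (-9 : 𝓞 K) * rel) (by linear_combination (6 : 𝓞 K) * rel)
    (by ring)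

/-- **`(11, θ - 9) 𝔭₁₃' = (4θ - 3)`** (`N = -143`). [folklore] -/
theorem P11c_mul_P13b_nineteen (hθ : aeval θ (csPoly 19) = 0) :
    span {(11 : 𝓞 K), thetaInt hθ - 9} * span {(13 : 𝓞 K), thetaInt hθ - 4} =
      span {4 * thetaInt hθ - 3} := by
  have rel := thetaInt_rel_nineteen hθ
  set t := thetaInt hθ with ht
  exact span_pair_mul_span_pair_eq_span_singleton
    (δ₁ := -16 * t ^ 2 + 292 * t - 69) (δ₂ := 4 * t ^ 2 - 73 * t + 20)
    (δ₃ := 12 * t ^ 2 - 219 * t + 55) (δ₄ := -3 * t ^ 2 + 55 * t - 16)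
    (u₁ := 1) (u₂ := -2) (u₃ := 2) (u₄ := 0)
    (by linear_combination (64 : 𝓞 K) * rel) (by linear_combination (-16 : 𝓞 K) * rel)
    (by linear_combination (-48 : 𝓞 K) * rel) (by linear_combination (12 : 𝓞 K) * rel)
    (by ring)

/-- **`𝔭₇ (13, θ - 3) = (θ - 3)`** (`N = 91`). [folklore] -/
theorem P7_mul_P13a_nineteen (hθ : aeval θ (csPoly 19) = 0) :
    span {(7 : 𝓞 K), thetaInt hθ - 3} * span {(13 : 𝓞 K), thetaInt hθ - 3} =
      span {thetaInt hθ - 3} := by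
  have rel := thetaInt_rel_nineteen hθ
  set t := thetaInt hθ with ht
  exact span_pair_mul_span_pair_eq_span_singleton
    (δ₁ := t ^ 2 - 16 * t - 30) (δ₂ := 7)
    (δ₃ := 13) (δ₄ := t - 3)
    (u₁ := 0) (u₂ := 2) (u₃ := -1) (u₄ := 0)
    (by linear_combination (-1 : 𝓞 K) * rel) (by ring)
    (by ring) (by ring)
    (by ring)

/-- **`𝔭₃ (13, θ - 12) = (θ + 1)`** (`N = 39`). [folklore] -/
theorem P3_mul_P13c_nineteen (hθ : aeval θ (csPoly 19) = 0) :
    span {(3 : 𝓞 K), thetaInt hθ - 2} * span {(13 : 𝓞 K), thetaInt hθ - 12} =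
      span {thetaInt hθ + 1} := by
  have rel := thetaInt_rel_nineteen hθ
  set t := thetaInt hθ with ht
  exact span_pair_mul_span_pair_eq_span_singleton
    (δ₁ := t ^ 2 - 20 * t + 38) (δ₂ := -t ^ 2 + 20 * t - 35)
    (δ₃ := -t ^ 2 + 20 * t - 25) (δ₄ := t ^ 2 - 19 * t + 23)
    (u₁ := -3) (u₂ := -4) (u₃ := 1) (u₄ := 0)
    (by linear_combination (-1 : 𝓞 K) * rel) (by linear_combination (1 : 𝓞 K) * rel)
    (by linear_combination (1 : 𝓞 K) * rel) (by linear_combination (-1 : 𝓞 K) * rel)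
    (by ring)

/-- **`𝔭₇ 𝔭₁₇ = (2θ + 1)`** (`N = 119`). [folklore] -/
theorem P7_mul_P17_nineteen (hθ : aeval θ (csPoly 19) = 0) :
    span {(7 : 𝓞 K), thetaInt hθ - 3} * span {(17 : 𝓞 K), thetaInt hθ - 8} =
      span {2 * thetaInt hθ + 1} := by
  have rel := thetaInt_rel_nineteen hθ
  set t := thetaInt hθ with ht
  exact span_pair_mul_span_pair_eq_span_singleton
    (δ₁ := 4 * t ^ 2 - 78 * t + 111) (δ₂ := -2 * t ^ 2 + 39 * t - 52)
    (δ₃ := -2 * t ^ 2 + 39 * t - 47) (δ₄ := t ^ 2 - 19 * t + 22)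
    (u₁ := -2) (u₂ := -7) (u₃ := 3) (u₄ := 0)
    (by linear_combination (-8 : 𝓞 K) * rel) (by linear_combination (4 : 𝓞 K) * rel)
    (by linear_combination (4 : 𝓞 K) * rel) (by linear_combination (-2 : 𝓞 K) * rel)
    (by ring)

/-- **`𝔭₁₃' 𝔭₁₉ = (3θ + 1)`** (`N = 247`). [folklore] -/
theorem P13b_mul_P19_nineteen (hθ : aeval θ (csPoly 19) = 0) :
    span {(13 : 𝓞 K), thetaInt hθ - 4} * span {(19 : 𝓞 K), thetaInt hθ - 6} =
      span {3 * thetaInt hθ + 1} := by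
  have rel := thetaInt_rel_nineteen hθ
  set t := thetaInt hθ with ht
  exact span_pair_mul_span_pair_eq_span_singleton
    (δ₁ := 9 * t ^ 2 - 174 * t + 220) (δ₂ := -3 * t ^ 2 + 58 * t - 69)
    (δ₃ := -3 * t ^ 2 + 58 * t - 67) (δ₄ := t ^ 2 - 19 * t + 21)
    (u₁ := 1) (u₂ := 9) (u₃ := -6) (u₄ := 0)
    (by linear_combination (-27 : 𝓞 K) * rel) (by linear_combination (9 : 𝓞 K) * rel)
    (by linear_combination (9 : 𝓞 K) * rel) (by linear_combination (-3 : 𝓞 K) * rel)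
    (by ring)

/-- **`(11, θ - 8) 𝔭₂₃ = (θ + 3)`** (`N = 253`). [folklore] -/
theorem P11b_mul_P23_nineteen (hθ : aeval θ (csPoly 19) = 0) :
    span {(11 : 𝓞 K), thetaInt hθ - 8} * span {(23 : 𝓞 K), thetaInt hθ - 20} =
      span {thetaInt hθ + 3} := by
  have rel := thetaInt_rel_nineteen hθ
  set t := thetaInt hθ with ht
  exact span_pair_mul_span_pair_eq_span_singleton
    (δ₁ := t ^ 2 - 22 * t + 84) (δ₂ := -t ^ 2 + 22 * t - 73)
    (δ₃ := -t ^ 2 + 22 * t - 61) (δ₄ := t ^ 2 - 21 * t + 53)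
    (u₁ := -1) (u₂ := -2) (u₃ := 1) (u₄ := 0)
    (by linear_combination (-1 : 𝓞 K) * rel) (by linear_combination (1 : 𝓞 K) * rel)
    (by linear_combination (1 : 𝓞 K) * rel) (by linear_combination (-1 : 𝓞 K) * rel)
    (by ring)

/-- **`(9, θ - 5) 𝔭₂₉ = (θ - 5)`** (`N = 261`). [folklore] -/
theorem P9_mul_P29_nineteen (hθ : aeval θ (csPoly 19) = 0) :
    span {(9 : 𝓞 K), thetaInt hθ - 5} * span {(29 : 𝓞 K), thetaInt hθ - 5} =
      span {thetaInt hθ - 5} := by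
  have rel := thetaInt_rel_nineteen hθ
  set t := thetaInt hθ with ht
  exact span_pair_mul_span_pair_eq_span_singleton
    (δ₁ := t ^ 2 - 14 * t - 52) (δ₂ := 9)
    (δ₃ := 29) (δ₄ := t - 5)
    (u₁ := 0) (u₂ := 13) (u₃ := -4) (u₄ := 0)
    (by linear_combination (-1 : 𝓞 K) * rel) (by ring)
    (by ring) (by ring)
    (by ring)

/-- **`(11, θ - 8) 𝔭₃₁ = (θ² - θ - 1)`** (`N = 341`). [folklore] -/
theorem P11b_mul_P31_nineteen (hθ : aeval θ (csPoly 19) = 0) :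
    span {(11 : 𝓞 K), thetaInt hθ - 8} * span {(31 : 𝓞 K), thetaInt hθ - 19} =
      span {thetaInt hθ ^ 2 - thetaInt hθ - 1} := by
  have rel := thetaInt_rel_nineteen hθ
  set t := thetaInt hθ with ht
  exact span_pair_mul_span_pair_eq_span_singleton
    (δ₁ := t ^ 2 - 323) (δ₂ := -11 * t + 198)
    (δ₃ := t ^ 2 - 31 * t + 235) (δ₄ := -t ^ 2 + 26 * t - 144)
    (u₁ := 3) (u₂ := 8) (u₃ := -2) (u₄ := 1)
    (by linear_combination (-t - 18) * rel) (by linear_combination (11 : 𝓞 K) * rel)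
    (by linear_combination (-t + 13) * rel) (by linear_combination (t - 8) * rel)
    (by ring)

/-- **`(13, θ - 3) 𝔭₃₇ = (θ - 16)`** (`N = 481`). [folklore] -/
theorem P13a_mul_P37_nineteen (hθ : aeval θ (csPoly 19) = 0) :
    span {(13 : 𝓞 K), thetaInt hθ - 3} * span {(37 : 𝓞 K), thetaInt hθ - 16} =
      span {thetaInt hθ - 16} := by
  have rel := thetaInt_rel_nineteen hθ
  set t := thetaInt hθ with ht
  exact span_pair_mul_span_pair_eq_span_singleton
    (δ₁ := t ^ 2 - 3 * t - 30) (δ₂ := 13)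
    (δ₃ := t ^ 2 - 3 * t + 7) (δ₄ := t - 3)
    (u₁ := -6) (u₂ := -17) (u₃ := 6) (u₄ := 0)
    (by linear_combination (-1 : 𝓞 K) * rel) (by ring)
    (by linear_combination (-1 : 𝓞 K) * rel) (by ring)
    (by ring)

/-- **`(11, θ - 8) 𝔭₄₃ = (2θ - 5)`** (`N = 473`). [folklore] -/
theorem P11b_mul_P43_nineteen (hθ : aeval θ (csPoly 19) = 0) :
    span {(11 : 𝓞 K), thetaInt hθ - 8} * span {(43 : 𝓞 K), thetaInt hθ - 24} =
      span {2 * thetaInt hθ - 5} := by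
  have rel := thetaInt_rel_nineteen hθ
  set t := thetaInt hθ with ht
  exact span_pair_mul_span_pair_eq_span_singleton
    (δ₁ := 4 * t ^ 2 - 66 * t - 93) (δ₂ := -2 * t ^ 2 + 33 * t + 52)
    (δ₃ := -2 * t ^ 2 + 33 * t + 68) (δ₄ := t ^ 2 - 16 * t - 38)
    (u₁ := 3) (u₂ := 8) (u₃ := -2) (u₄ := 0)
    (by linear_combination (-8 : 𝓞 K) * rel) (by linear_combination (4 : 𝓞 K) * rel)
    (by linear_combination (4 : 𝓞 K) * rel) (by linear_combination (-2 : 𝓞 K) * rel)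
    (by ring)

/-- **`(11, θ - 9) 𝔭₄₇ = (3θ - 5)`** (`N = 517`). [folklore] -/
theorem P11c_mul_P47_nineteen (hθ : aeval θ (csPoly 19) = 0) :
    span {(11 : 𝓞 K), thetaInt hθ - 9} * span {(47 : 𝓞 K), thetaInt hθ - 33} =
      span {3 * thetaInt hθ - 5} := by
  have rel := thetaInt_rel_nineteen hθ
  set t := thetaInt hθ with ht
  exact span_pair_mul_span_pair_eq_span_singleton
    (δ₁ := 9 * t ^ 2 - 156 * t - 98) (δ₂ := -6 * t ^ 2 + 104 * t + 69)
    (δ₃ := -6 * t ^ 2 + 104 * t + 81) (δ₄ := 4 * t ^ 2 - 69 * t - 57)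
    (u₁ := -2) (u₂ := -4) (u₃ := 1) (u₄ := 0)
    (by linear_combination (-27 : 𝓞 K) * rel) (by linear_combination (18 : 𝓞 K) * rel)
    (by linear_combination (18 : 𝓞 K) * rel) (by linear_combination (-12 : 𝓞 K) * rel)
    (by ring)

/-- **`(11, θ - 9) 𝔭₅₉ = (θ - 9)`** (`N = 649`). [folklore] -/
theorem P11c_mul_P59_nineteen (hθ : aeval θ (csPoly 19) = 0) :
    span {(11 : 𝓞 K), thetaInt hθ - 9} * span {(59 : 𝓞 K), thetaInt hθ - 9} =
      span {thetaInt hθ - 9} := by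
  have rel := thetaInt_rel_nineteen hθ
  set t := thetaInt hθ with ht
  exact span_pair_mul_span_pair_eq_span_singleton
    (δ₁ := t ^ 2 - 10 * t - 72) (δ₂ := 11)
    (δ₃ := 59) (δ₄ := t - 9)
    (u₁ := 0) (u₂ := -16) (u₃ := 3) (u₄ := 0)
    (by linear_combination (-1 : 𝓞 K) * rel) (by ring)
    (by ring) (by ring)
    (by ring)

/-- **`(11, θ - 2) 𝔭₆₁ = (5θ + 1)`** (`N = 671`). [folklore] -/
theorem P11a_mul_P61_nineteen (hθ : aeval θ (csPoly 19) = 0) :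
    span {(11 : 𝓞 K), thetaInt hθ - 2} * span {(61 : 𝓞 K), thetaInt hθ - 12} =
      span {5 * thetaInt hθ + 1} := by
  have rel := thetaInt_rel_nineteen hθ
  set t := thetaInt hθ with ht
  exact span_pair_mul_span_pair_eq_span_singleton
    (δ₁ := 25 * t ^ 2 - 480 * t + 546) (δ₂ := -5 * t ^ 2 + 96 * t - 107)
    (δ₃ := -5 * t ^ 2 + 96 * t - 97) (δ₄ := t ^ 2 - 19 * t + 19)
    (u₁ := 1) (u₂ := 6) (u₃ := -1) (u₄ := 0)
    (by linear_combination (-125 : 𝓞 K) * rel) (by linear_combination (25 : 𝓞 K) * rel)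
    (by linear_combination (25 : 𝓞 K) * rel) (by linear_combination (-5 : 𝓞 K) * rel)
    (by ring)

/-- **`(11, θ - 2) 𝔭₇₁ = (θ - 13)`** (`N = 781`). [folklore] -/
theorem P11a_mul_P71_nineteen (hθ : aeval θ (csPoly 19) = 0) :
    span {(11 : 𝓞 K), thetaInt hθ - 2} * span {(71 : 𝓞 K), thetaInt hθ - 13} =
      span {thetaInt hθ - 13} := by
  have rel := thetaInt_rel_nineteen hθ
  set t := thetaInt hθ with ht
  exact span_pair_mul_span_pair_eq_span_singleton
    (δ₁ := t ^ 2 - 6 * t - 60) (δ₂ := 11)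
    (δ₃ := t ^ 2 - 6 * t + 11) (δ₄ := t - 2)
    (u₁ := 2) (u₂ := 13) (u₃ := -2) (u₄ := 0)
    (by linear_combination (-1 : 𝓞 K) * rel) (by ring)
    (by linear_combination (-1 : 𝓞 K) * rel) (by ring)
    (by ring)

/-- **`𝔭₃ 𝔭₇₃ = (5θ - 4)`** (`N = -219`). [folklore] -/
theorem P3_mul_P73_nineteen (hθ : aeval θ (csPoly 19) = 0) :
    span {(3 : 𝓞 K), thetaInt hθ - 2} * span {(73 : 𝓞 K), thetaInt hθ - 30} =
      span {5 * thetaInt hθ - 4} := by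
  have rel := thetaInt_rel_nineteen hθ
  set t := thetaInt hθ with ht
  exact span_pair_mul_span_pair_eq_span_singleton
    (δ₁ := -25 * t ^ 2 + 455 * t - 86) (δ₂ := 10 * t ^ 2 - 182 * t + 35)
    (δ₃ := 10 * t ^ 2 - 182 * t + 49) (δ₄ := -4 * t ^ 2 + 73 * t - 20)
    (u₁ := 10) (u₂ := 26) (u₃ := -1) (u₄ := 0)
    (by linear_combination (125 : 𝓞 K) * rel) (by linear_combination (-50 : 𝓞 K) * rel)
    (by linear_combination (-50 : 𝓞 K) * rel) (by linear_combination (20 : 𝓞 K) * rel)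
    (by ring)


/-! ### The class group has order dividing `6`: generators `a = [𝔭₃]` (order `3`) and `b = [𝔭₁₃']` (order `2`) -/

/-- `𝔭₃ = (3, θ - 2)` is a nonzero ideal. [folklore] -/
theorem P3_mem_nonZeroDivisors_nineteen (hθ : aeval θ (csPoly 19) = 0) :
    span {(3 : 𝓞 K), thetaInt hθ - 2} ∈ (Ideal (𝓞 K))⁰ := by
  have h := span_pair_natCast_mem_nonZeroDivisors (K := K) (n := 3) (Nat.succ_ne_zero 2)
    (thetaInt hθ - 2)
  simp only [Nat.cast_ofNat] at h
  exact h

/-- `𝔭₁₃' = (13, θ - 4)` is a nonzero ideal. [folklore] -/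
theorem P13b_mem_nonZeroDivisors_nineteen (hθ : aeval θ (csPoly 19) = 0) :
    span {(13 : 𝓞 K), thetaInt hθ - 4} ∈ (Ideal (𝓞 K))⁰ := by
  have h := span_pair_natCast_mem_nonZeroDivisors (K := K) (n := 13) (by norm_num)
    (thetaInt hθ - 4)
  simp only [Nat.cast_ofNat] at h
  exact h

/-- `𝔭₇ = (7, θ - 3)` is a nonzero ideal. [folklore] -/
theorem P7_mem_nonZeroDivisors_nineteen (hθ : aeval θ (csPoly 19) = 0) :
    span {(7 : 𝓞 K), thetaInt hθ - 3} ∈ (Ideal (𝓞 K))⁰ := by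
  have h := span_pair_natCast_mem_nonZeroDivisors (K := K) (n := 7) (by norm_num)
    (thetaInt hθ - 3)
  simp only [Nat.cast_ofNat] at h
  exact h

/-- `(9, θ - 5)` is a nonzero ideal. [folklore] -/
theorem P9_mem_nonZeroDivisors_nineteen (hθ : aeval θ (csPoly 19) = 0) :
    span {(9 : 𝓞 K), thetaInt hθ - 5} ∈ (Ideal (𝓞 K))⁰ := by
  have h := span_pair_natCast_mem_nonZeroDivisors (K := K) (n := 9) (by norm_num)
    (thetaInt hθ - 5)
  simp only [Nat.cast_ofNat] at h
  exact h

/-- `(11, θ - 8)` is a nonzero ideal. [folklore] -/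
theorem P11b_mem_nonZeroDivisors_nineteen (hθ : aeval θ (csPoly 19) = 0) :
    span {(11 : 𝓞 K), thetaInt hθ - 8} ∈ (Ideal (𝓞 K))⁰ := by
  have h := span_pair_natCast_mem_nonZeroDivisors (K := K) (n := 11) (by norm_num)
    (thetaInt hθ - 8)
  simp only [Nat.cast_ofNat] at h
  exact h

/-- **Every ideal class of the trace `19` field is one of `1`, `[(11, θ - 8)]`, `[(9, θ - 5)]`,
`[(13, θ - 4)]`, `[(3, θ - 2)]`, `[(7, θ - 3)]`** — the powers `g⁰, …, g⁵` of `g = [𝔭₃][𝔭₁₃']`, where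
`[𝔭₃]³ = 1` (`𝔭₃² = (9, θ - 5)`, `𝔭₃ (9, θ - 5) = (2θ - 1)`) and `[𝔭₁₃']² = 1` (`𝔭₁₃'² = (θ - 4)`); so the
class number divides `6`. Proof: `d_K = 72329`, `⌊M_K⌋ ≤ 76`, Dedekind–Kummer at `p ≤ 76` and the
relations listed in the module docstring. [cite: KimYamada2023, §6.1 (proof of Thm. B)] -/
theorem classGroup_mem_six_nineteen (hθ : aeval θ (csPoly 19) = 0) (h3 : finrank ℚ K = 3)
    (C : ClassGroup (𝓞 K)) :
    C = 1 ∨ C = ClassGroup.mk0 ⟨span {(11 : 𝓞 K), thetaInt hθ - 8}, P11b_mem_nonZeroDivisors_nineteen hθ⟩ ∨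
      C = ClassGroup.mk0 ⟨span {(9 : 𝓞 K), thetaInt hθ - 5}, P9_mem_nonZeroDivisors_nineteen hθ⟩ ∨
      C = ClassGroup.mk0 ⟨span {(13 : 𝓞 K), thetaInt hθ - 4}, P13b_mem_nonZeroDivisors_nineteen hθ⟩ ∨
      C = ClassGroup.mk0 ⟨span {(3 : 𝓞 K), thetaInt hθ - 2}, P3_mem_nonZeroDivisors_nineteen hθ⟩ ∨
      C = ClassGroup.mk0 ⟨span {(7 : 𝓞 K), thetaInt hθ - 3}, P7_mem_nonZeroDivisors_nineteen hθ⟩ := by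
  classical
  have rel := thetaInt_rel_nineteen hθ
  set t := thetaInt hθ with ht
  have hne : ∀ (x y : 𝓞 K) (n : ℕ), x * y = n → n ≠ 0 → x ≠ 0 := by
    rintro x y n hxy hn rfl
    rw [zero_mul] at hxy
    exact hn (by exact_mod_cast hxy.symm)
  have hne1 : 2 * t - 1 ≠ 0 :=
    hne _ (-4 * t ^ 2 + 74 * t - 35) 27 (by push_cast; linear_combination (-8 : 𝓞 K) * rel)
      (by norm_num)
  have hne2 : t - 4 ≠ 0 :=
    hne _ (t ^ 2 - 15 * t - 42) 169 (by push_cast; linear_combination (1 : 𝓞 K) * rel)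
      (by norm_num)
  have hne3 : t - 17 ≠ 0 :=
    hne _ (t ^ 2 - 2 * t - 16) 273 (by push_cast; linear_combination (1 : 𝓞 K) * rel)
      (by norm_num)
  have hne4 : t - 2 ≠ 0 :=
    hne _ (t ^ 2 - 17 * t - 16) 33 (by push_cast; linear_combination (1 : 𝓞 K) * rel)
      (by norm_num)
  have hne5 : 3 * t - 2 ≠ 0 :=
    hne _ (-9 * t ^ 2 + 165 * t - 52) 77 (by push_cast; linear_combination (-27 : 𝓞 K) * rel)
      (by norm_num)
  have hne6 : 4 * t - 3 ≠ 0 :=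
    hne _ (-16 * t ^ 2 + 292 * t - 69) 143 (by push_cast; linear_combination (-64 : 𝓞 K) * rel)
      (by norm_num)
  have hne7 : t - 3 ≠ 0 :=
    hne _ (t ^ 2 - 16 * t - 30) 91 (by push_cast; linear_combination (1 : 𝓞 K) * rel)
      (by norm_num)
  have hne8 : t + 1 ≠ 0 :=
    hne _ (t ^ 2 - 20 * t + 38) 39 (by push_cast; linear_combination (1 : 𝓞 K) * rel)
      (by norm_num)
  have hne9 : 2 * t + 1 ≠ 0 :=
    hne _ (4 * t ^ 2 - 78 * t + 111) 119 (by push_cast; linear_combination (8 : 𝓞 K) * rel)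
      (by norm_num)
  have hne10 : 3 * t + 1 ≠ 0 :=
    hne _ (9 * t ^ 2 - 174 * t + 220) 247 (by push_cast; linear_combination (27 : 𝓞 K) * rel)
      (by norm_num)
  have hne11 : t + 3 ≠ 0 :=
    hne _ (t ^ 2 - 22 * t + 84) 253 (by push_cast; linear_combination (1 : 𝓞 K) * rel)
      (by norm_num)
  have hne12 : t - 5 ≠ 0 :=
    hne _ (t ^ 2 - 14 * t - 52) 261 (by push_cast; linear_combination (1 : 𝓞 K) * rel)
      (by norm_num)
  have hne13 : t ^ 2 - t - 1 ≠ 0 :=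
    hne _ (t ^ 2 - 323) 341 (by push_cast; linear_combination (t + 18) * rel)
      (by norm_num)
  have hne14 : t - 16 ≠ 0 :=
    hne _ (t ^ 2 - 3 * t - 30) 481 (by push_cast; linear_combination (1 : 𝓞 K) * rel)
      (by norm_num)
  have hne15 : 2 * t - 5 ≠ 0 :=
    hne _ (4 * t ^ 2 - 66 * t - 93) 473 (by push_cast; linear_combination (8 : 𝓞 K) * rel)
      (by norm_num)
  have hne16 : 3 * t - 5 ≠ 0 :=
    hne _ (9 * t ^ 2 - 156 * t - 98) 517 (by push_cast; linear_combination (27 : 𝓞 K) * rel)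
      (by norm_num)
  have hne17 : t - 9 ≠ 0 :=
    hne _ (t ^ 2 - 10 * t - 72) 649 (by push_cast; linear_combination (1 : 𝓞 K) * rel)
      (by norm_num)
  have hne18 : 5 * t + 1 ≠ 0 :=
    hne _ (25 * t ^ 2 - 480 * t + 546) 671 (by push_cast; linear_combination (125 : 𝓞 K) * rel)
      (by norm_num)
  have hne19 : t - 13 ≠ 0 :=
    hne _ (t ^ 2 - 6 * t - 60) 781 (by push_cast; linear_combination (1 : 𝓞 K) * rel)
      (by norm_num)
  have hne20 : 5 * t - 4 ≠ 0 :=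
    hne _ (-25 * t ^ 2 + 455 * t - 86) 219 (by push_cast; linear_combination (-125 : 𝓞 K) * rel)
      (by norm_num)
  have hinv : ∀ (P Q : Ideal (𝓞 K)) (hP0 : P ∈ (Ideal (𝓞 K))⁰) (hQ0 : Q ∈ (Ideal (𝓞 K))⁰) (x : 𝓞 K),
      x ≠ 0 → P * Q = span {x} → ClassGroup.mk0 ⟨P, hP0⟩ = (ClassGroup.mk0 ⟨Q, hQ0⟩)⁻¹ := by
    intro P Q hP0 hQ0 x hx hPQ
    exact ClassGroup.mk0_eq_mk0_inv_iff.mpr ⟨x, hx, by simpa using hPQ⟩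
  have hnz : ∀ (n : ℕ) (hn : n ≠ 0) (x : 𝓞 K), span {(n : 𝓞 K), x} ∈ (Ideal (𝓞 K))⁰ :=
    fun n hn x => span_pair_natCast_mem_nonZeroDivisors (K := K) hn x
  have hP3 : span {(3 : 𝓞 K), t - 2} ∈ (Ideal (𝓞 K))⁰ := P3_mem_nonZeroDivisors_nineteen hθ
  have hP13b : span {(13 : 𝓞 K), t - 4} ∈ (Ideal (𝓞 K))⁰ := P13b_mem_nonZeroDivisors_nineteen hθ
  have hP7 : span {(7 : 𝓞 K), t - 3} ∈ (Ideal (𝓞 K))⁰ := P7_mem_nonZeroDivisors_nineteen hθ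
  have hP9 : span {(9 : 𝓞 K), t - 5} ∈ (Ideal (𝓞 K))⁰ := P9_mem_nonZeroDivisors_nineteen hθ
  have hP11b : span {(11 : 𝓞 K), t - 8} ∈ (Ideal (𝓞 K))⁰ := P11b_mem_nonZeroDivisors_nineteen hθ
  have hP39 : span {(39 : 𝓞 K), t - 17} ∈ (Ideal (𝓞 K))⁰ := by
    have h := hnz 39 (by norm_num) (t - 17)
    simp only [Nat.cast_ofNat] at h
    exact h
  have hP11a : span {(11 : 𝓞 K), t - 2} ∈ (Ideal (𝓞 K))⁰ := by
    have h := hnz 11 (by norm_num) (t - 2)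
    simp only [Nat.cast_ofNat] at h
    exact h
  have hP11c : span {(11 : 𝓞 K), t - 9} ∈ (Ideal (𝓞 K))⁰ := by
    have h := hnz 11 (by norm_num) (t - 9)
    simp only [Nat.cast_ofNat] at h
    exact h
  have hP13a : span {(13 : 𝓞 K), t - 3} ∈ (Ideal (𝓞 K))⁰ := by
    have h := hnz 13 (by norm_num) (t - 3)
    simp only [Nat.cast_ofNat] at h
    exact h
  set a : ClassGroup (𝓞 K) := ClassGroup.mk0 ⟨span {(3 : 𝓞 K), t - 2}, hP3⟩ with ha
  set b : ClassGroup (𝓞 K) := ClassGroup.mk0 ⟨span {(13 : 𝓞 K), t - 4}, hP13b⟩ with hb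
  set g : ClassGroup (𝓞 K) := ClassGroup.mk0 ⟨span {(39 : 𝓞 K), t - 17}, hP39⟩ with hg
  -- `g = a b`, `a² = [(9, θ - 5)] = a⁻¹`, `b² = 1`
  have hgab : g = a * b := by
    rw [hg, ha, hb, ← map_mul]
    congr 1
    exact Subtype.ext (by simpa using (P3_mul_P13b_nineteen hθ).symm)
  have h9cls : ClassGroup.mk0 ⟨span {(9 : 𝓞 K), t - 5}, hP9⟩ = a⁻¹ :=
    hinv _ _ hP9 hP3 _ hne1 (by rw [mul_comm]; exact P3_mul_P9_nineteen hθ)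
  have hsq : a * a = a⁻¹ := by
    rw [← h9cls, ha, ← map_mul]
    congr 1
    exact Subtype.ext (by simpa using P3_mul_P3_nineteen hθ)
  have ha3 : a ^ (3 : ℤ) = 1 := by
    rw [show (3 : ℤ) = 2 + 1 by norm_num, zpow_add, zpow_two, zpow_one, hsq, inv_mul_cancel]
  have hb2 : b * b = 1 := by
    have h : b = b⁻¹ := ClassGroup.mk0_eq_mk0_inv_iff.mpr ⟨_, hne2, by simpa using P13b_mul_P13b_nineteen hθ⟩
    rwa [eq_inv_iff_mul_eq_one] at h
  have hbinv : b⁻¹ = b := by rw [eq_comm, eq_inv_iff_mul_eq_one, hb2]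
  -- powers of `g`
  have hg2 : g ^ (2 : ℤ) = a⁻¹ := by
    rw [zpow_two, hgab, mul_mul_mul_comm, hsq, hb2, mul_one]
  have hg3 : g ^ (3 : ℤ) = b := by
    rw [show (3 : ℤ) = 2 + 1 by norm_num, zpow_add, hg2, zpow_one, hgab, ← mul_assoc, inv_mul_cancel,
      one_mul]
  have hg4 : g ^ (4 : ℤ) = a := by
    rw [show (4 : ℤ) = 2 + 2 by norm_num, zpow_add, hg2, ← mul_inv, hsq, inv_inv]
  have hg5 : g ^ (5 : ℤ) = a⁻¹ * b := by
    rw [show (5 : ℤ) = 2 + 3 by norm_num, zpow_add, hg2, hg3]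
  have hg6 : g ^ (6 : ℤ) = 1 := by
    rw [show (6 : ℤ) = 3 + 3 by norm_num, zpow_add, hg3, hb2]
  let H : Subgroup (ClassGroup (𝓞 K)) := Subgroup.zpowers g
  -- every element `aⁱ bʲ` lies in `H`
  have hmemH : ∀ x : ClassGroup (𝓞 K), (x = 1 ∨ x = a ∨ x = a⁻¹ ∨ x = b ∨ x = a * b ∨ x = a⁻¹ * b ∨
      x = (a * b)⁻¹ ∨ x = (a⁻¹ * b)⁻¹ ∨ x = b⁻¹ ∨ x = (a⁻¹)⁻¹) → x ∈ H := by
    rintro x (rfl | rfl | rfl | rfl | rfl | rfl | rfl | rfl | rfl | rfl)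
    · exact H.one_mem
    · rw [← hg4]; exact Subgroup.zpow_mem_zpowers g 4
    · rw [← hg2]; exact Subgroup.zpow_mem_zpowers g 2
    · rw [← hg3]; exact Subgroup.zpow_mem_zpowers g 3
    · rw [← hgab]; exact Subgroup.mem_zpowers g
    · rw [← hg5]; exact Subgroup.zpow_mem_zpowers g 5
    · rw [← hgab]; exact H.inv_mem (Subgroup.mem_zpowers g)
    · rw [← hg5]; exact H.inv_mem (Subgroup.zpow_mem_zpowers g 5)
    · rw [← hg3]; exact H.inv_mem (Subgroup.zpow_mem_zpowers g 3)
    · rw [← hg4, inv_inv]; exact Subgroup.zpow_mem_zpowers g 4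
  have hprinc : ∀ (P : Ideal (𝓞 K)) (hP0 : P ∈ (Ideal (𝓞 K))⁰) (x : 𝓞 K), P = span {x} →
      ClassGroup.mk0 ⟨P, hP0⟩ ∈ H := by
    intro P hP0 x hPx
    have : ClassGroup.mk0 ⟨P, hP0⟩ = 1 :=
      (ClassGroup.mk0_eq_one_iff hP0).mpr ⟨⟨x, by rw [hPx, submodule_span_eq]⟩⟩
    rw [this]
    exact H.one_mem
  -- classes of the auxiliary primes
  have h7cls : ClassGroup.mk0 ⟨span {(7 : 𝓞 K), t - 3}, hP7⟩ = (a * b)⁻¹ := by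
    rw [← hgab]
    exact hinv _ _ hP7 hP39 _ hne3 (by rw [mul_comm]; exact P39_mul_P7_nineteen hθ)
  have h11acls : ClassGroup.mk0 ⟨span {(11 : 𝓞 K), t - 2}, hP11a⟩ = a⁻¹ :=
    hinv _ _ hP11a hP3 _ hne4 (by rw [mul_comm]; exact P3_mul_P11a_nineteen hθ)
  have h11bcls : ClassGroup.mk0 ⟨span {(11 : 𝓞 K), t - 8}, hP11b⟩ = a * b := by
    rw [hinv _ _ hP11b hP7 _ hne5 (by rw [mul_comm]; exact P7_mul_P11b_nineteen hθ), h7cls, inv_inv]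
  have h11ccls : ClassGroup.mk0 ⟨span {(11 : 𝓞 K), t - 9}, hP11c⟩ = b⁻¹ :=
    hinv _ _ hP11c hP13b _ hne6 (P11c_mul_P13b_nineteen hθ)
  have h13acls : ClassGroup.mk0 ⟨span {(13 : 𝓞 K), t - 3}, hP13a⟩ = a * b := by
    rw [hinv _ _ hP13a hP7 _ hne7 (by rw [mul_comm]; exact P7_mul_P13a_nineteen hθ), h7cls, inv_inv]
  have h7cls2 : ClassGroup.mk0 ⟨span {(7 : 𝓞 K), t - 3}, hP7⟩ = a⁻¹ * b := by
    rw [h7cls, mul_inv_rev, hbinv, mul_comm]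
  -- Minkowski: `⌊M_K⌋ ≤ 76`
  have hd : ((|NumberField.discr K| : ℤ) : ℝ) ≤ (72329 : ℕ) := by
    rw [discr_eq_nineteen hθ h3]
    norm_num
  have hfloor := floor_minkowskiBound_le_cubic h3 hd (s := 269) (U := 76) (by norm_num)
    (by norm_num) (by norm_num)
  have htop : H = ⊤ := by
    refine classGroup_subgroup_eq_top_of_primesOver H hfloor fun p hp hprime P hP0 hP hle => ?_
    have hpU : p ≤ 76 := (Finset.mem_Icc.mp hp).2
    have h1p : 1 ≤ p := (Finset.mem_Icc.mp hp).1
    interval_cases p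
    · exact absurd hprime (by decide)
    · exact hprinc P hP0 _ (eq_span_of_inert_nineteen hθ h3 (by norm_num) hP)
    · -- `p = 3`
      rcases eq_P3_or_eq_Q3_nineteen hθ h3 hP with h | h <;> subst h
      · rw [show ClassGroup.mk0 ⟨_, hP0⟩ = a from rfl]
        exact hmemH _ (by simp)
      · rw [hinv _ _ hP0 hP3 3 (by norm_num) (by rw [mul_comm]; exact P3_mul_Q3_nineteen hθ), show ClassGroup.mk0 ⟨_, hP3⟩ = a from rfl]
        exact hmemH _ (by simp)
    · exact absurd hprime (by decide)
    · exact hprinc P hP0 _ (eq_span_of_inert_nineteen hθ h3 (by norm_num) hP)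
    · exact absurd hprime (by decide)
    · -- `p = 7`
      rcases eq_P7_or_eq_Q7_nineteen hθ h3 hP with h | h <;> subst h
      · rw [show ClassGroup.mk0 ⟨_, hP0⟩ = ClassGroup.mk0 ⟨_, hP7⟩ from rfl, h7cls]
        exact hmemH _ (by simp)
      · rw [hinv _ _ hP0 hP7 7 (by norm_num) (by rw [mul_comm]; exact P7_mul_Q7_nineteen hθ), h7cls]
        exact hmemH _ (by simp)
    · exact absurd hprime (by decide)
    · exact absurd hprime (by decide)
    · exact absurd hprime (by decide)
    · -- `p = 11` (splits)
      rcases eq_P11_nineteen hθ h3 hP with h | h | h <;> subst h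
      · rw [show ClassGroup.mk0 ⟨_, hP0⟩ = ClassGroup.mk0 ⟨_, hP11a⟩ from rfl, h11acls]
        exact hmemH _ (by simp)
      · rw [show ClassGroup.mk0 ⟨_, hP0⟩ = ClassGroup.mk0 ⟨_, hP11b⟩ from rfl, h11bcls]
        exact hmemH _ (by simp)
      · rw [show ClassGroup.mk0 ⟨_, hP0⟩ = ClassGroup.mk0 ⟨_, hP11c⟩ from rfl, h11ccls]
        exact hmemH _ (by simp)
    · exact absurd hprime (by decide)
    · -- `p = 13` (splits)
      rcases eq_P13_nineteen hθ h3 hP with h | h | h <;> subst h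
      · rw [show ClassGroup.mk0 ⟨_, hP0⟩ = ClassGroup.mk0 ⟨_, hP13a⟩ from rfl, h13acls]
        exact hmemH _ (by simp)
      · rw [show ClassGroup.mk0 ⟨_, hP0⟩ = b from rfl]
        exact hmemH _ (by simp)
      · rw [hinv _ _ hP0 hP3 _ hne8 (by rw [mul_comm]; exact P3_mul_P13c_nineteen hθ), show ClassGroup.mk0 ⟨_, hP3⟩ = a from rfl]
        exact hmemH _ (by simp)
    · exact absurd hprime (by decide)
    · exact absurd hprime (by decide)
    · exact absurd hprime (by decide)
    · -- `p = 17`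
      have h := eq_span_pair_of_unique_root_nineteen hθ h3 (Or.inl ⟨rfl, rfl⟩) hP hle
      simp only [Nat.cast_ofNat, Int.cast_ofNat] at h
      subst h
      rw [hinv _ _ hP0 hP7 _ hne9 (by rw [mul_comm]; exact P7_mul_P17_nineteen hθ), h7cls]
      exact hmemH _ (by simp)
    · exact absurd hprime (by decide)
    · -- `p = 19`
      have h := eq_span_pair_of_unique_root_nineteen hθ h3 (Or.inr (Or.inl ⟨rfl, rfl⟩)) hP hle
      simp only [Nat.cast_ofNat, Int.cast_ofNat] at h
      subst h
      rw [hinv _ _ hP0 hP13b _ hne10 (by rw [mul_comm]; exact P13b_mul_P19_nineteen hθ), show ClassGroup.mk0 ⟨_, hP13b⟩ = b from rfl]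
      exact hmemH _ (by simp)
    · exact absurd hprime (by decide)
    · exact absurd hprime (by decide)
    · exact absurd hprime (by decide)
    · -- `p = 23`
      have h := eq_span_pair_of_unique_root_nineteen hθ h3 (Or.inr (Or.inr (Or.inl ⟨rfl, rfl⟩))) hP hle
      simp only [Nat.cast_ofNat, Int.cast_ofNat] at h
      subst h
      rw [hinv _ _ hP0 hP11b _ hne11 (by rw [mul_comm]; exact P11b_mul_P23_nineteen hθ), h11bcls]
      exact hmemH _ (by simp)
    · exact absurd hprime (by decide)
    · exact absurd hprime (by decide)
    · exact absurd hprime (by decide)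
    · exact absurd hprime (by decide)
    · exact absurd hprime (by decide)
    · -- `p = 29`
      have h := eq_span_pair_of_unique_root_nineteen hθ h3 (Or.inr (Or.inr (Or.inr (Or.inl ⟨rfl, rfl⟩)))) hP hle
      simp only [Nat.cast_ofNat, Int.cast_ofNat] at h
      subst h
      rw [hinv _ _ hP0 hP9 _ hne12 (by rw [mul_comm]; exact P9_mul_P29_nineteen hθ), h9cls]
      exact hmemH _ (by simp)
    · exact absurd hprime (by decide)
    · -- `p = 31`
      have h := eq_span_pair_of_unique_root_nineteen hθ h3 (Or.inr (Or.inr (Or.inr (Or.inr (Or.inl ⟨rfl, rfl⟩))))) hP hle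
      simp only [Nat.cast_ofNat, Int.cast_ofNat] at h
      subst h
      rw [hinv _ _ hP0 hP11b _ hne13 (by rw [mul_comm]; exact P11b_mul_P31_nineteen hθ), h11bcls]
      exact hmemH _ (by simp)
    · exact absurd hprime (by decide)
    · exact absurd hprime (by decide)
    · exact absurd hprime (by decide)
    · exact absurd hprime (by decide)
    · exact absurd hprime (by decide)
    · -- `p = 37`
      have h := eq_span_pair_of_unique_root_nineteen hθ h3 (Or.inr (Or.inr (Or.inr (Or.inr (Or.inr (Or.inl ⟨rfl, rfl⟩)))))) hP hle
      simp only [Nat.cast_ofNat, Int.cast_ofNat] at h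
      subst h
      rw [hinv _ _ hP0 hP13a _ hne14 (by rw [mul_comm]; exact P13a_mul_P37_nineteen hθ), h13acls]
      exact hmemH _ (by simp)
    · exact absurd hprime (by decide)
    · exact absurd hprime (by decide)
    · exact absurd hprime (by decide)
    · exact hprinc P hP0 _ (eq_span_of_inert_nineteen hθ h3 (by norm_num) hP)
    · exact absurd hprime (by decide)
    · -- `p = 43`
      have h := eq_span_pair_of_unique_root_nineteen hθ h3 (Or.inr (Or.inr (Or.inr (Or.inr (Or.inr (Or.inr (Or.inl ⟨rfl, rfl⟩))))))) hP hle
      simp only [Nat.cast_ofNat, Int.cast_ofNat] at h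
      subst h
      rw [hinv _ _ hP0 hP11b _ hne15 (by rw [mul_comm]; exact P11b_mul_P43_nineteen hθ), h11bcls]
      exact hmemH _ (by simp)
    · exact absurd hprime (by decide)
    · exact absurd hprime (by decide)
    · exact absurd hprime (by decide)
    · -- `p = 47`
      have h := eq_span_pair_of_unique_root_nineteen hθ h3 (Or.inr (Or.inr (Or.inr (Or.inr (Or.inr (Or.inr (Or.inr (Or.inl ⟨rfl, rfl⟩)))))))) hP hle
      simp only [Nat.cast_ofNat, Int.cast_ofNat] at h
      subst h
      rw [hinv _ _ hP0 hP11c _ hne16 (by rw [mul_comm]; exact P11c_mul_P47_nineteen hθ), h11ccls]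
      exact hmemH _ (by simp)
    · exact absurd hprime (by decide)
    · exact absurd hprime (by decide)
    · exact absurd hprime (by decide)
    · exact absurd hprime (by decide)
    · exact absurd hprime (by decide)
    · exact hprinc P hP0 _ (eq_span_of_inert_nineteen hθ h3 (by norm_num) hP)
    · exact absurd hprime (by decide)
    · exact absurd hprime (by decide)
    · exact absurd hprime (by decide)
    · exact absurd hprime (by decide)
    · exact absurd hprime (by decide)
    · -- `p = 59`
      have h := eq_span_pair_of_unique_root_nineteen hθ h3 (Or.inr (Or.inr (Or.inr (Or.inr (Or.inr (Or.inr (Or.inr (Or.inr (Or.inl ⟨rfl, rfl⟩))))))))) hP hle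
      simp only [Nat.cast_ofNat, Int.cast_ofNat] at h
      subst h
      rw [hinv _ _ hP0 hP11c _ hne17 (by rw [mul_comm]; exact P11c_mul_P59_nineteen hθ), h11ccls]
      exact hmemH _ (by simp)
    · exact absurd hprime (by decide)
    · -- `p = 61`
      have h := eq_span_pair_of_unique_root_nineteen hθ h3 (Or.inr (Or.inr (Or.inr (Or.inr (Or.inr (Or.inr (Or.inr (Or.inr (Or.inr (Or.inl ⟨rfl, rfl⟩)))))))))) hP hle
      simp only [Nat.cast_ofNat, Int.cast_ofNat] at h
      subst h
      rw [hinv _ _ hP0 hP11a _ hne18 (by rw [mul_comm]; exact P11a_mul_P61_nineteen hθ), h11acls]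
      exact hmemH _ (by simp)
    · exact absurd hprime (by decide)
    · exact absurd hprime (by decide)
    · exact absurd hprime (by decide)
    · exact absurd hprime (by decide)
    · exact absurd hprime (by decide)
    · exact hprinc P hP0 _ (eq_span_of_inert_nineteen hθ h3 (by norm_num) hP)
    · exact absurd hprime (by decide)
    · exact absurd hprime (by decide)
    · exact absurd hprime (by decide)
    · -- `p = 71`
      have h := eq_span_pair_of_unique_root_nineteen hθ h3 (Or.inr (Or.inr (Or.inr (Or.inr (Or.inr (Or.inr (Or.inr (Or.inr (Or.inr (Or.inr (Or.inl ⟨rfl, rfl⟩))))))))))) hP hle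
      simp only [Nat.cast_ofNat, Int.cast_ofNat] at h
      subst h
      rw [hinv _ _ hP0 hP11a _ hne19 (by rw [mul_comm]; exact P11a_mul_P71_nineteen hθ), h11acls]
      exact hmemH _ (by simp)
    · exact absurd hprime (by decide)
    · -- `p = 73`
      have h := eq_span_pair_of_unique_root_nineteen hθ h3 (Or.inr (Or.inr (Or.inr (Or.inr (Or.inr (Or.inr (Or.inr (Or.inr (Or.inr (Or.inr (Or.inr (⟨rfl, rfl⟩)))))))))))) hP hle
      simp only [Nat.cast_ofNat, Int.cast_ofNat] at h
      subst h
      rw [hinv _ _ hP0 hP3 _ hne20 (by rw [mul_comm]; exact P3_mul_P73_nineteen hθ), show ClassGroup.mk0 ⟨_, hP3⟩ = a from rfl]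
      exact hmemH _ (by simp)
    · exact absurd hprime (by decide)
    · exact absurd hprime (by decide)
    · exact absurd hprime (by decide)
  have hC : C ∈ H := by rw [htop]; exact Subgroup.mem_top C
  obtain ⟨k, rfl⟩ := Subgroup.mem_zpowers_iff.mp hC
  obtain ⟨q, r, hr, rfl⟩ : ∃ q r : ℤ, (r = 0 ∨ r = 1 ∨ r = 2 ∨ r = 3 ∨ r = 4 ∨ r = 5) ∧ k = 6 * q + r :=
    ⟨k / 6, k % 6, by omega, by omega⟩
  rw [zpow_add, zpow_mul, hg6, one_zpow, one_mul]
  rcases hr with rfl | rfl | rfl | rfl | rfl | rfl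
  · exact Or.inl (zpow_zero g)
  · right; left
    rw [zpow_one, hgab, ← h11bcls]
  · right; right; left
    rw [hg2, ← h9cls]
  · right; right; right; left
    rw [hg3]
  · right; right; right; right; left
    rw [hg4]
  · right; right; right; right; right
    rw [hg5, ← h7cls2]


end Field


/-! ### The ideal classes of `ℤ[X]/(f₁₉)` and Gompf's conjecture for the traces `19` and `-14` -/

section Matrices

/-- **The ideal classes of `ℤ[Θ₁₉] = ℤ[X]/(f₁₉)`**: every non-zero ideal is in the class of one of
`⟨Θ - 1, 1⟩`, `⟨Θ - 8, 11⟩`, `⟨Θ - 5, 9⟩`, `⟨Θ - 4, 13⟩`, `⟨Θ - 2, 3⟩`, `⟨Θ - 3, 7⟩` (six representatives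
cover `C(ℤ[Θ₁₉])`). [cite: KimYamada2023, §6.1 (proof of Thm. B)] -/
theorem ideal_class_adjoinRoot_nineteen (J : Ideal (AdjoinRoot (csPoly 19))) (hJ : J ≠ ⊥) :
    ∃ x y : AdjoinRoot (csPoly 19), x ≠ 0 ∧ y ≠ 0 ∧
      (span {x} * J = span {y} * csIdeal 1 1 19 ∨ span {x} * J = span {y} * csIdeal 8 11 19 ∨ span {x} * J = span {y} * csIdeal 5 9 19 ∨ span {x} * J = span {y} * csIdeal 4 13 19 ∨ span {x} * J = span {y} * csIdeal 2 3 19 ∨ span {x} * J = span {y} * csIdeal 3 7 19) := by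
  classical
  set θ' := AdjoinRoot.root (csPolyQ 19) with hθ'
  have hθ : aeval θ' (csPoly 19) = 0 := aeval_root_csPoly 19
  have h3 : finrank ℚ (CSField 19) = 3 := finrank_CSField 19
  obtain ⟨e, he⟩ := exists_ringEquiv_adjoinRoot_of_sq hθ h3 csDisc_nineteen_sq
  set I : Ideal (𝓞 (CSField 19)) := J.map e with hI
  have hIJ : I.map (e.symm : 𝓞 (CSField 19) →+* AdjoinRoot (csPoly 19)) = J := by
    rw [hI]
    exact Ideal.map_of_equiv e (I := J)
  have hI0 : I ≠ ⊥ := by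
    intro h0
    apply hJ
    rw [← hIJ, h0, Ideal.map_bot]
  have hImem : I ∈ (Ideal (𝓞 (CSField 19)))⁰ := mem_nonZeroDivisors_iff_ne_zero.mpr hI0
  have hsymm : ∀ x, (e.symm : 𝓞 (CSField 19) →+* AdjoinRoot (csPoly 19)) (e x) = x :=
    fun x => e.symm_apply_apply x
  have hP11b : (span {(11 : 𝓞 (CSField 19)), thetaInt hθ - 8}).map
      (e.symm : 𝓞 (CSField 19) →+* AdjoinRoot (csPoly 19)) = csIdeal 8 11 19 := by
    rw [Ideal.map_span, Set.image_insert_eq, Set.image_singleton, map_sub, ← he, hsymm, map_ofNat,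
      map_ofNat, csIdeal, Set.pair_comm]
    simp
  have hP9 : (span {(9 : 𝓞 (CSField 19)), thetaInt hθ - 5}).map
      (e.symm : 𝓞 (CSField 19) →+* AdjoinRoot (csPoly 19)) = csIdeal 5 9 19 := by
    rw [Ideal.map_span, Set.image_insert_eq, Set.image_singleton, map_sub, ← he, hsymm, map_ofNat,
      map_ofNat, csIdeal, Set.pair_comm]
    simp
  have hP13b : (span {(13 : 𝓞 (CSField 19)), thetaInt hθ - 4}).map
      (e.symm : 𝓞 (CSField 19) →+* AdjoinRoot (csPoly 19)) = csIdeal 4 13 19 := by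
    rw [Ideal.map_span, Set.image_insert_eq, Set.image_singleton, map_sub, ← he, hsymm, map_ofNat,
      map_ofNat, csIdeal, Set.pair_comm]
    simp
  have hP3 : (span {(3 : 𝓞 (CSField 19)), thetaInt hθ - 2}).map
      (e.symm : 𝓞 (CSField 19) →+* AdjoinRoot (csPoly 19)) = csIdeal 2 3 19 := by
    rw [Ideal.map_span, Set.image_insert_eq, Set.image_singleton, map_sub, ← he, hsymm, map_ofNat,
      map_ofNat, csIdeal, Set.pair_comm]
    simp
  have hP7 : (span {(7 : 𝓞 (CSField 19)), thetaInt hθ - 3}).map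
      (e.symm : 𝓞 (CSField 19) →+* AdjoinRoot (csPoly 19)) = csIdeal 3 7 19 := by
    rw [Ideal.map_span, Set.image_insert_eq, Set.image_singleton, map_sub, ← he, hsymm, map_ofNat,
      map_ofNat, csIdeal, Set.pair_comm]
    simp
  have hcase : ∀ (P : Ideal (𝓞 (CSField 19))) (hP0 : P ∈ (Ideal (𝓞 (CSField 19)))⁰)
      (Q : Ideal (AdjoinRoot (csPoly 19))),
      P.map (e.symm : 𝓞 (CSField 19) →+* AdjoinRoot (csPoly 19)) = Q →
      ClassGroup.mk0 ⟨I, hImem⟩ = ClassGroup.mk0 ⟨P, hP0⟩ →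
        ∃ x y : AdjoinRoot (csPoly 19), x ≠ 0 ∧ y ≠ 0 ∧ span {x} * J = span {y} * Q := by
    intro P hP0 Q hPQ hcls
    obtain ⟨x, y, hx, hy, hxy⟩ := ClassGroup.mk0_eq_mk0_iff.mp hcls
    refine ⟨(e.symm : 𝓞 (CSField 19) →+* AdjoinRoot (csPoly 19)) x,
      (e.symm : 𝓞 (CSField 19) →+* AdjoinRoot (csPoly 19)) y,
      (map_ne_zero_iff _ e.symm.injective).mpr hx, (map_ne_zero_iff _ e.symm.injective).mpr hy, ?_⟩
    have h := congrArg (Ideal.map (e.symm : 𝓞 (CSField 19) →+* AdjoinRoot (csPoly 19))) hxy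
    simp only [Ideal.map_mul, Ideal.map_span, Set.image_singleton] at h
    rw [hIJ, hPQ] at h
    exact h
  rcases classGroup_mem_six_nineteen hθ h3 (ClassGroup.mk0 ⟨I, hImem⟩) with h1 | hcl | hcl | hcl | hcl | hcl
  · obtain ⟨z, hz⟩ := ((ClassGroup.mk0_eq_one_iff hImem).mp h1).principal
    have hz' : I = span {z} := by rw [hz, submodule_span_eq]
    have hz0 : z ≠ 0 := by
      rintro rfl
      apply hI0
      rw [hz', Ideal.span_singleton_eq_bot]
    refine ⟨1, (e.symm : 𝓞 (CSField 19) →+* AdjoinRoot (csPoly 19)) z, one_ne_zero,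
      (map_ne_zero_iff _ e.symm.injective).mpr hz0, Or.inl ?_⟩
    rw [Ideal.span_singleton_one, Ideal.top_mul, csIdeal_one_one, Ideal.mul_top, ← hIJ, hz',
      Ideal.map_span, Set.image_singleton]
  · obtain ⟨x, y, hx, hy, h⟩ := hcase _ _ _ hP11b hcl
    exact ⟨x, y, hx, hy, Or.inr (Or.inl h)⟩
  · obtain ⟨x, y, hx, hy, h⟩ := hcase _ _ _ hP9 hcl
    exact ⟨x, y, hx, hy, Or.inr (Or.inr (Or.inl h))⟩
  · obtain ⟨x, y, hx, hy, h⟩ := hcase _ _ _ hP13b hcl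
    exact ⟨x, y, hx, hy, Or.inr (Or.inr (Or.inr (Or.inl h)))⟩
  · obtain ⟨x, y, hx, hy, h⟩ := hcase _ _ _ hP3 hcl
    exact ⟨x, y, hx, hy, Or.inr (Or.inr (Or.inr (Or.inr (Or.inl h))))⟩
  · obtain ⟨x, y, hx, hy, h⟩ := hcase _ _ _ hP7 hcl
    exact ⟨x, y, hx, hy, Or.inr (Or.inr (Or.inr (Or.inr (Or.inr (h)))))⟩

/-- `11 ∣ f₁₉(8)`: `(8, 11, 19) ∈ 𝒞𝒮`. [cite: KimYamada2023, §6.1 (proof of Thm. B)] -/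
theorem rep0_dvd_eval_csPoly_nineteen : (11 : ℤ) ∣ (csPoly 19).eval 8 := by
  rw [eval_csPoly]; norm_num

/-- `9 ∣ f₁₉(5)`: `(5, 9, 19) ∈ 𝒞𝒮`. [cite: KimYamada2023, §6.1 (proof of Thm. B)] -/
theorem rep1_dvd_eval_csPoly_nineteen : (9 : ℤ) ∣ (csPoly 19).eval 5 := by
  rw [eval_csPoly]; norm_num

/-- `13 ∣ f₁₉(4)`: `(4, 13, 19) ∈ 𝒞𝒮`. [cite: KimYamada2023, §6.1 (proof of Thm. B)] -/
theorem rep2_dvd_eval_csPoly_nineteen : (13 : ℤ) ∣ (csPoly 19).eval 4 := by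
  rw [eval_csPoly]; norm_num

/-- `3 ∣ f₁₉(2)`: `(2, 3, 19) ∈ 𝒞𝒮`. [cite: KimYamada2023, §6.1 (proof of Thm. B)] -/
theorem rep3_dvd_eval_csPoly_nineteen : (3 : ℤ) ∣ (csPoly 19).eval 2 := by
  rw [eval_csPoly]; norm_num

/-- `7 ∣ f₁₉(3)`: `(3, 7, 19) ∈ 𝒞𝒮`. [cite: KimYamada2023, §6.1 (proof of Thm. B)] -/
theorem rep4_dvd_eval_csPoly_nineteen : (7 : ℤ) ∣ (csPoly 19).eval 3 := by
  rw [eval_csPoly]; norm_num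

/-- **Every Cappell–Shaneson matrix of trace `19` is similar to one of six standard matrices**
(Prop. 2.14). [cite: KimYamada2023, §6.1 (proof of Thm. B) and Prop. 2.14] -/
theorem isConj_standardCSMatrix_of_trace_eq_nineteen (A : SL(3, ℤ))
    (hdet : ((A : Matrix (Fin 3) (Fin 3) ℤ) - 1).det = 1)
    (htr : Matrix.trace (A : Matrix (Fin 3) (Fin 3) ℤ) = 19) :
    IsConj A (standardCSMatrix 1 1 19 (one_dvd _)) ∨
      IsConj A (standardCSMatrix 8 11 19 rep0_dvd_eval_csPoly_nineteen) ∨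
      IsConj A (standardCSMatrix 5 9 19 rep1_dvd_eval_csPoly_nineteen) ∨
      IsConj A (standardCSMatrix 4 13 19 rep2_dvd_eval_csPoly_nineteen) ∨
      IsConj A (standardCSMatrix 2 3 19 rep3_dvd_eval_csPoly_nineteen) ∨
      IsConj A (standardCSMatrix 3 7 19 rep4_dvd_eval_csPoly_nineteen) := by
  have hcover : ∀ J : Ideal (AdjoinRoot (csPoly 19)), J ≠ ⊥ →
      ∃ (c d : ℤ) (_ : d ∣ (csPoly 19).eval c) (x y : AdjoinRoot (csPoly 19)),
        x ≠ 0 ∧ y ≠ 0 ∧ Ideal.span {x} * J = Ideal.span {y} * csIdeal c d 19 ∧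
          ((c = 1 ∧ d = 1) ∨ (c = 8 ∧ d = 11) ∨ (c = 5 ∧ d = 9) ∨ (c = 4 ∧ d = 13) ∨ (c = 2 ∧ d = 3) ∨ (c = 3 ∧ d = 7)) := by
    intro J hJ
    obtain ⟨x, y, hx, hy, hxy⟩ := ideal_class_adjoinRoot_nineteen J hJ
    rcases hxy with h0 | h1 | h2 | h3 | h4 | h5
    · exact ⟨1, 1, one_dvd _, x, y, hx, hy, h0, Or.inl ⟨rfl, rfl⟩⟩
    · exact ⟨8, 11, rep0_dvd_eval_csPoly_nineteen, x, y, hx, hy, h1, Or.inr (Or.inl ⟨rfl, rfl⟩)⟩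
    · exact ⟨5, 9, rep1_dvd_eval_csPoly_nineteen, x, y, hx, hy, h2, Or.inr (Or.inr (Or.inl ⟨rfl, rfl⟩))⟩
    · exact ⟨4, 13, rep2_dvd_eval_csPoly_nineteen, x, y, hx, hy, h3, Or.inr (Or.inr (Or.inr (Or.inl ⟨rfl, rfl⟩)))⟩
    · exact ⟨2, 3, rep3_dvd_eval_csPoly_nineteen, x, y, hx, hy, h4, Or.inr (Or.inr (Or.inr (Or.inr (Or.inl ⟨rfl, rfl⟩))))⟩
    · exact ⟨3, 7, rep4_dvd_eval_csPoly_nineteen, x, y, hx, hy, h5, Or.inr (Or.inr (Or.inr (Or.inr (Or.inr (⟨rfl, rfl⟩)))))⟩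
  obtain ⟨c, d, h, hconj, hcd⟩ := exists_isConj_standardCSMatrix_of_cover _ hcover A hdet htr
  rcases hcd with ⟨rfl, rfl⟩ | ⟨rfl, rfl⟩ | ⟨rfl, rfl⟩ | ⟨rfl, rfl⟩ | ⟨rfl, rfl⟩ | ⟨rfl, rfl⟩
  · exact Or.inl hconj
  · exact Or.inr (Or.inl hconj)
  · exact Or.inr (Or.inr (Or.inl hconj))
  · exact Or.inr (Or.inr (Or.inr (Or.inl hconj)))
  · exact Or.inr (Or.inr (Or.inr (Or.inr (Or.inl hconj))))
  · exact Or.inr (Or.inr (Or.inr (Or.inr (Or.inr (hconj)))))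

/-- **Kim–Yamada 2023, Theorem B for the trace `19`, PROVED**: the five non-trivial classes move by
Gompf moves to the traces `8`, `10`, `6`, `10`, `5`, where Gompf's conjecture holds. [cite: KimYamada2023, Thm. B and §6.1] -/
theorem gompfConjectureForTrace_nineteen : GompfConjectureForTrace 19 := by
  intro A hdet htr
  rcases isConj_standardCSMatrix_of_trace_eq_nineteen A hdet htr with h0 | h1 | h2 | h3 | h4 | h5
  · exact (GompfEquiv.of_isConj h0).trans (gompfEquiv_standardCSMatrix_one_one 17 (one_dvd _))
  · exact (GompfEquiv.of_isConj h1).trans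
      (gompfEquiv_standardCSMatrix_akbulutKirbyMatrix_of_modEq
        (gompfConjectureForTrace_of_mem_Icc (by norm_num)) rep0_dvd_eval_csPoly_nineteen
        (show (19 : ℤ) ≡ 8 [ZMOD 11] by decide))
  · exact (GompfEquiv.of_isConj h2).trans
      (gompfEquiv_standardCSMatrix_akbulutKirbyMatrix_of_modEq
        (gompfConjectureForTrace_ten_of aitchisonRubinstein1984_traceNegFiveClasses_holds) rep1_dvd_eval_csPoly_nineteen
        (show (19 : ℤ) ≡ 10 [ZMOD 9] by decide))
  · exact (GompfEquiv.of_isConj h3).trans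
      (gompfEquiv_standardCSMatrix_akbulutKirbyMatrix_of_modEq
        (gompfConjectureForTrace_of_mem_Icc (by norm_num)) rep2_dvd_eval_csPoly_nineteen
        (show (19 : ℤ) ≡ 6 [ZMOD 13] by decide))
  · exact (GompfEquiv.of_isConj h4).trans
      (gompfEquiv_standardCSMatrix_akbulutKirbyMatrix_of_modEq
        (gompfConjectureForTrace_ten_of aitchisonRubinstein1984_traceNegFiveClasses_holds) rep3_dvd_eval_csPoly_nineteen
        (show (19 : ℤ) ≡ 10 [ZMOD 3] by decide))
  · exact (GompfEquiv.of_isConj h5).trans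
      (gompfEquiv_standardCSMatrix_akbulutKirbyMatrix_of_modEq
        (gompfConjectureForTrace_of_mem_Icc (by norm_num)) rep4_dvd_eval_csPoly_nineteen
        (show (19 : ℤ) ≡ 5 [ZMOD 7] by decide))

/-- **Theorem B for the trace `-14`** (`= 5 - 19`), by Theorem A. [cite: KimYamada2023, Thm. A and Thm. B] -/
theorem gompfConjectureForTrace_neg_fourteen : GompfConjectureForTrace (-14) := by
  have h := gompfConjectureForTrace_of_five_sub gompfConjectureForTrace_nineteen
  norm_num at h
  exact h

end Matrices


end Literature.Topology.FourManifolds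

end
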